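import Summits.BirchSwinnertonDyer.BirchSwinnertonDyer.Theorems.PrintX11aLowerHalfOfChildrenFourPartner
import Summits.BirchSwinnertonDyer.BirchSwinnertonDyer.Theorems.PrintX10bAnalyticMuZeroX10b
import HarnessLib

/-!
# Crux `X11aLowerHalf` (item stmt-BirchSwinnertonDyer-19064), the weight-two PARTNER road at `p = 3` WITHOUT the
# Emerton–Pollack–Weston `∗ = an` transfer and WITHOUT the period-unit fact: Greenberg's analytic `μ₃ = 0` at the
# good-ordinary partner is a THEOREM of the tree (LINE `theoremB-x10b`, crux 20682 `PrintX10b.AnalyticMuZeroX10b`, CLOSED)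
# (width seat bsd-line-er5-p2 = -w3, p = 3 binder, gen 7; `--supports stmt-BirchSwinnertonDyer-19064` helper)

HONEST FRAMING.  Theorems only; no definition, no named fact minted, no `sorry`.  §1 is UNCONDITIONAL (fact-free).  Every other
theorem is CONDITIONAL on DISPLAYED statement-only named published facts (never proved; the Emerton–Pollack–Weston odd-prime instances
carry the disclosure token `EPW06@3-Hida-control`, Yan–Zhu Thm. 4.9 the token `YZ26@3-BF-ERL-Ohta`, Skinner–Urban 3.6.4 (ram) the
counting flag `SU14-12.3.6-mu@nonsplit@3`) and on displayed PER-PAIR ∕ residual statements; the gate records a `conditional-result`;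
nothing is closed; BSD is proved for no curve and no class; PARTITION 0.  beyond-print theorem: no.

## What and why

The partner road of width seat er5-p2 g4 (`PrintX11aLowerHalfThreePartner.lean`, p627615; contra currency
`PrintX11aLowerHalfThreePartnerContra.lean`, p629328) proves the lower half at a deep X11a pair with `p = 3` whose `E[3]` is finite flat
at `3` from a good-ordinary `3`-congruent partner `A` and FIVE partner-road facts: EPW Cor. 5.1.4 (`hEPW`), Yan–Zhu Thm. 4.9 (`hYZ`), the
period unit at the good prime `3` (`h3`), EPW Thm. 1 `∗ = alg` (`hTa`) and `∗ = an` (`hTn`) mult ⟶ good.  Two of the five are NOT NEEDED: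

* `hTn` (`thm1_muAn_transfer_goodOrdinary_of_mult_odd`) is consumed ONCE, to obtain «some coefficient of `ϖ · L_3(f_A, α_A)` is a 3-adic
  unit» at the partner.  But Greenberg's analytic `μ₃ = 0` at ANY globally minimal curve GOOD ORDINARY at `3` with irreducible `3`-torsion is
  a THEOREM of the tree — the five registered stubs of LINE `theoremB-x10b` (cell bsd-f3-mu ∕ bsd-print-x8 ∕ x9 ∕ x10: Vaserstein over
  `ℤ[1/m]`, THEOREM B = the cyclotomic winding classes span, AN-9 non-constancy of `x ↦ [x]⁺ mod 3`, a unit value of the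
  Mazur–Swinnerton-Dyer measure, a unit coefficient of `L_3(f, α)`), composed exactly as in
  `Cruxes.AnalyticMuZeroX10b.TheoremB.AnalyticMuZeroX10b_of` (p-closing file `PrintX10bAnalyticMuZeroX10b.lean`; the class hypothesis
  there only supplies ordinarity and irreducibility).  §1 below states it class-free: `exists_norm_coeff_padicLFunction_eq_one_of_goodOrdinary_three`.
* `h3` (`realPeriodRat_eq_unit_mul_plusPeriod_three`) is the tree's theorem `SkinnerUrban2014.realPeriodRat_eq_unit_mul_plusPeriod_three_of_mazur`
  given Mazur 1978 Cor. 4.1 (`hMz`), which every door of the road ALREADY takes (INPUTS desk T21, p637825).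

So this file re-proves g4's chain with the THREE partner facts `hEPW`, `hYZ`, `hTa` (§2–§7) and gives the skeleton-level composition
for a reshaped line r12 (§8): `stub_threePartnerFactsLower := cor514 ∧ YZ 4.9 ∧ EPW Thm. 1 alg`.  Counting (INPUTS-LIST-2 ADD-15 §B
convention): distinct named facts displayed on 19064's line 26 (r10) → 25 (r11, T21) → 24 (r12, this file).  The children ∕ leaf glues
for r12 are in the sequel `PrintX11aLowerHalfOfChildrenThreePartner.lean`.  No summit statement is proved by this seat.

References: [MazurTateTeitelbaum1986Invent] §I.10–I.13; [Vaserstein1972SL2]; [BassMilnorSerre1967] I.3.6; [Stevens1982] §1.1;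
[GreenbergVatsal2000] §3 Remark (3.4), Prop. (3.7); [Mazur1978] Cor. 4.1; [EmertonPollackWeston2006] Thm. 1, Thm. 3.1.1, Thm. 5.1.3,
Cor. 5.1.4; [YanZhu2024MainConjNonCM] Thm. 4.9; [SkinnerUrban2014] §3.6.7, Thm. 3.6.4; [Wuthrich2014] Thm. 3, Cor. 18, Lemma 20;
[Kato2004Asterisque] Thm. 12.4, §17.13; [SteinWuthrich2013] Thm. 6.1; [Wan2015] Thm. 4; [GreenbergLNM1716] Conj. 1.11; [Miller2011LMS]
Def. 1.1; cell files `Cruxes/X11aLowerHalf/Lines/birth.lean` (r10), `Cruxes/AnalyticMuZeroX10b/Lines/theoremB_x10b.lean`.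
-/

set_option autoImplicit false
set_option linter.dupNamespace false -- the directory name repeats the summit name (sibling precedent)

noncomputable section

open scoped Classical MatrixGroups ModularForm

open CongruenceSubgroup UpperHalfPlane WeierstrassCurve IsDedekindDomain Rat.HeightOneSpectrum
  Literature.NumberTheory.EllipticCurves
  Literature.NumberTheory.EllipticCurves.ModularForms
  Literature.NumberTheory.EllipticCurves.Rank1Residual
  Literature.NumberTheory.EllipticCurves.Rank1Residual.Typed
  Literature.NumberTheory.EllipticCurves.Wuthrich2014
  Literature.NumberTheory.EllipticCurves.SteinWuthrich2013
  Literature.NumberTheory.EllipticCurves.Greenberg1999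
  Literature.NumberTheory.EllipticCurves.Kato2004
  Literature.NumberTheory.EllipticCurves.GreenbergVatsal2000
  Literature.NumberTheory.EllipticCurves.EmertonPollackWeston2006
  Literature.NumberTheory.EllipticCurves.SkinnerUrban2014
  Literature.NumberTheory.EllipticCurves.BalakrishnanEtAl2019
  Literature.NumberTheory.GaloisRepresentations
  Literature.NumberTheory.Automorphic
  Summit.BirchSwinnertonDyer.Rank1Residual
  Summit.BirchSwinnertonDyer.Rank1Residual.X11a
  Summit.BirchSwinnertonDyer.BirchSwinnertonDyer.Theorems.OddChain

namespace Summit.BirchSwinnertonDyer.BirchSwinnertonDyer.Theorems.ThreePartner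

/-! ### §1 Greenberg's analytic `μ₃ = 0` at a good-ordinary curve with irreducible `3`-torsion — FACT-FREE (LINE theoremB-x10b) -/

/-- **Greenberg's analytic `μ = 0` at `p = 3`, class-free and fact-free**: for a globally minimal `A/ℚ` GOOD ORDINARY at `3`
(`3 ∤ a_3`) with `A[3]` irreducible and any newform `f` of `A`, some coefficient of `L_3(f, α_A)` is a `3`-adic unit.  The five
registered stubs of LINE `theoremB-x10b` (all tree theorems, no named fact) composed as in
`Cruxes.AnalyticMuZeroX10b.TheoremB.AnalyticMuZeroX10b_of`: Vaserstein over `ℤ[1/m]` ⟹ THEOREM B ⟹ AN-9 non-constancy ⟹ a unit value of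
the Mazur–Swinnerton-Dyer measure ⟹ a unit coefficient.  UNCONDITIONAL.
[cite: MazurTateTeitelbaum1986Invent, §I.10 (10.1)–(10.2) and §I.13] [cite: Vaserstein1972SL2, Theorem, p. 313] [cite: Stevens1982, §1.1] -/
theorem exists_norm_coeff_padicLFunction_eq_one_of_goodOrdinary_three
    (A : WeierstrassCurve ℚ) [A.IsElliptic] [A.IsGloballyMinimal]
    (hgoodA : A.HasGoodReductionAtPrime 3) (hordA : ¬ (3 : ℤ) ∣ A.frobeniusTrace 3)
    (hirrA : A.HasIrreducibleModPGaloisRep 3) {N : ℕ} [NeZero N] (f : CuspForm (Gamma0 N) 2) (hf : IsNewformOf A f) :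
    ∃ n : ℕ, ‖PowerSeries.coeff n (padicLFunction f (unitRoot A 3 : ℚ_[3]))‖ = 1 := by
  have hord : IsOrdinaryAt A 3 := (isOrdinaryAt_iff A 3).mpr ⟨hgoodA, hordA⟩
  exact Summit.BirchSwinnertonDyer.BirchSwinnertonDyer.Cruxes.AnalyticMuZeroX10b.TheoremB.stub_muAnZero_of_unitMeasure A f hord hf hirrA
    (Summit.BirchSwinnertonDyer.BirchSwinnertonDyer.Cruxes.AnalyticMuZeroX10b.TheoremB.stub_unitMeasure_of_nonconstancy A f hord hf hirrA
      (Summit.BirchSwinnertonDyer.BirchSwinnertonDyer.Cruxes.AnalyticMuZeroX10b.TheoremB.stub_nonconstancy_of_theoremB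
        (Summit.BirchSwinnertonDyer.BirchSwinnertonDyer.Cruxes.AnalyticMuZeroX10b.TheoremB.stub_theoremB_of_vasersteinAway
          Summit.BirchSwinnertonDyer.BirchSwinnertonDyer.Cruxes.AnalyticMuZeroX10b.TheoremB.stub_vasersteinAway)
        A 3 (by decide) hgoodA hirrA))

/-- **The CONCLUSION of EPW Thm. 1 `∗ = an` (mult ⟶ good) at `p = 3`, Néron-normalised — for EVERY good-ordinary curve with irreducible
`3`-torsion, from Mazur 1978 Cor. 4.1 alone** (no multiplicative source, no congruence): §1 and the period unit `ϖ ∈ ℤ₍₃₎ˣ`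
(`norm_periodRatio_eq_one_three` fed `SkinnerUrban2014.realPeriodRat_eq_unit_mul_plusPeriod_three_of_mazur`).  CONDITIONAL on `hMz` only.
[cite: Mazur1978, Cor. 4.1] [cite: GreenbergVatsal2000, §3 Remark (3.4) and Prop. (3.7)] [cite: MazurTateTeitelbaum1986Invent, §I.13] -/
theorem exists_norm_coeff_C_mul_padicLFunction_eq_one_of_goodOrdinary_three_of_mazur
    (hMz : mazur_not_dvd_maninConstant_of_odd)
    (A : WeierstrassCurve ℚ) [A.IsElliptic] [A.IsGloballyMinimal]
    (hgoodA : A.HasGoodReductionAtPrime 3) (hordA : ¬ (3 : ℤ) ∣ A.frobeniusTrace 3)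
    (hirrA : A.HasIrreducibleModPGaloisRep 3) {N : ℕ} [NeZero N] (f : CuspForm (Gamma0 N) 2) (hf : IsNewformOf A f)
    (ϖ : ℚ) (hϖeq : (ϖ : ℝ) * A.realPeriodRat = plusPeriod f) :
    ∃ n : ℕ, ‖PowerSeries.coeff n (PowerSeries.C (ϖ : ℚ_[3]) * padicLFunction f (unitRoot A 3 : ℚ_[3]))‖ = 1 := by
  have hϖnorm : ‖(ϖ : ℚ_[3])‖ = 1 :=
    norm_periodRatio_eq_one_three (realPeriodRat_eq_unit_mul_plusPeriod_three_of_mazur hMz) A hgoodA hirrA f hf ϖ hϖeq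
  obtain ⟨n, hn⟩ := exists_norm_coeff_padicLFunction_eq_one_of_goodOrdinary_three A hgoodA hordA hirrA f hf
  exact ⟨n, by rw [PowerSeries.coeff_C_mul, norm_mul, hϖnorm, one_mul]; exact hn⟩

/-! ### §2 The partner's integral identity with `μ = 0` from THREE partner facts -/

section Partner

variable (W A : WeierstrassCurve ℚ) [W.IsElliptic] [W.IsGloballyMinimal] [A.IsElliptic] [A.IsGloballyMinimal]

/-- **`GoodOrdinaryCharIdealMuZero A 3` for a good-ordinary `3`-congruent partner `A` of a curve `E = W` MULTIPLICATIVE at `3` with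
`E[3]` irreducible, `μ^an(E,3) = 0` (`hμ`) and the typed divisibility at `(E,3)` (`hdiv`) — g4's `goodOrdinaryCharIdealMuZero_three_of_partner`
WITHOUT `hTn` and `h3`**: `μ^an(A) = 0` is §1 (tree theorem), the period unit is Mazur's (`hMz`).  Facts used: Yan–Zhu Thm. 4.9 (`hYZ`),
EPW Thm. 1 `∗ = alg` mult ⟶ good (`hTa`), Mazur Cor. 4.1 (`hMz`), a modular parametrisation (`hpar`).  CONDITIONAL; per pair.
[cite: YanZhu2024MainConjNonCM, Thm. 4.9 (§4.4; v4 Thm. 5.2)] [cite: EmertonPollackWeston2006, Thm. 1 (arXiv:math/0404484 p. 2), Thm. 3.1.1 (p. 17)]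
[cite: Mazur1978, Cor. 4.1] [cite: GreenbergVatsal2000, Prop. (3.7)] -/
theorem goodOrdinaryCharIdealMuZero_three_of_partner_of_theoremB
    (hYZ : YanZhu2026.thm49_charIdeal_eq_padicLFunction) (hTa : thm1_muAlg_transfer_goodOrdinary_of_mult_odd)
    (hMz : mazur_not_dvd_maninConstant_of_odd) (hpar : nonempty_modularParametrizationData)
    (hmult : W.HasMultiplicativeReductionAtPrime 3) (hirr : W.HasIrreducibleModPGaloisRep 3)
    (hdiv : X11b.MultDivisibilityAt W 3) (hμ : X11a.MuAnZeroAt W 3)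
    (hgoodA : A.HasGoodReductionAtPrime 3) (hordA : ¬ ((3 : ℕ) : ℤ) ∣ A.frobeniusTrace 3)
    (hiso : ∃ e : geomTorsion W ((3 : ℕ) : ℤ) ≃+ geomTorsion A ((3 : ℕ) : ℤ),
      ∀ (σ : Field.absoluteGaloisGroup ℚ) (P : geomTorsion W ((3 : ℕ) : ℤ)), e (σ • P) = σ • e P) :
    GoodOrdinaryCharIdealMuZero A 3 := by
  have h32 : (3 : ℕ) ≠ 2 := by decide
  have h3 : realPeriodRat_eq_unit_mul_plusPeriod_three := realPeriodRat_eq_unit_mul_plusPeriod_three_of_mazur hMz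
  have hordA' : ¬ (3 : ℤ) ∣ A.frobeniusTrace 3 := by exact_mod_cast hordA
  obtain ⟨e, he⟩ := hiso
  have hirrA : A.HasIrreducibleModPGaloisRep 3 := hasIrreducibleModPGaloisRep_of_torsionIso e he hirr
  -- `μ^alg(E) = 0` (Kato's side + the certificate), then `μ^alg(A) = 0` (EPW Thm. 1, ∗ = alg)
  have hμalgE : ∀ (κ : ZpExtension ℚ 3) (γ : Field.absoluteGaloisGroup ℚ), κ.IsCyclotomic →
      κ.IsTopGenerator γ → IsCyclotomicVariable 3 γ →
      ∀ D : W.SelmerDualData κ γ, D.IsTorsion ∧ D.mu = 0 :=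
    fun κ γ hκ hγ hγ' D =>
      NonSurjChain.isTorsion_and_mu_eq_zero_of_muAnZeroAt_of_multDivisibilityAt W 3 hpar hmult hdiv hμ hκ hγ
        hγ' D
  have hμalgA := hTa W A 3 h32 hmult hgoodA hordA ⟨e, he⟩ hirr hμalgE
  intro κ γ hκ hγ hγ' _ f hf ϖ hϖeq D
  have hϖnorm : ‖(ϖ : ℚ_[3])‖ = 1 := norm_periodRatio_eq_one_three h3 A hgoodA hirrA f hf ϖ hϖeq
  -- `μ^an(A) = 0`: a THEOREM of the tree at a good-ordinary `3` (§1), no transfer needed; Néron-normalised by Mazur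
  have hcert : ∃ n : ℕ, ‖PowerSeries.coeff n (padicLFunction f (unitRoot A 3 : ℚ_[3]))‖ = 1 :=
    exists_norm_coeff_padicLFunction_eq_one_of_goodOrdinary_three A hgoodA hordA' hirrA f hf
  have hcertϖ : ∃ n : ℕ, ‖PowerSeries.coeff n
      (PowerSeries.C (ϖ : ℚ_[3]) * padicLFunction f (unitRoot A 3 : ℚ_[3]))‖ = 1 :=
    exists_norm_coeff_C_mul_padicLFunction_eq_one_of_goodOrdinary_three_of_mazur hMz A hgoodA hordA' hirrA f hf ϖ hϖeq
  -- the rational identity at `A` (Yan–Zhu 4.9) upgraded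
  obtain ⟨hX, g, hchar, hιg⟩ :=
    mazurMainConjecture_of_mu_eq_zero_of_rationalMC A 3 (rationalMC_of_yanZhu A 3 hYZ h32 hgoodA hordA hirrA)
      h32 hgoodA hordA hirrA κ γ hκ hγ hγ' f hf D (hμalgA κ γ hκ hγ hγ' D).2 hcert
  -- rescale the generator by the unit `ϖ ∈ ℤ₃ˣ`
  set c : ℤ_[3] := ⟨(ϖ : ℚ_[3]), hϖnorm.le⟩ with hc_def
  have hcu : IsUnit c := PadicInt.isUnit_iff.mpr hϖnorm
  have hιcg : iwasawaToPowerSeries 3 (PowerSeries.C c * g) =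
      PowerSeries.C (ϖ : ℚ_[3]) * padicLFunction f (unitRoot A 3 : ℚ_[3]) := by
    rw [map_mul, hιg, PowerSeries.map_C]
    rfl
  refine ⟨hX, PowerSeries.C c * g, ?_, hasUnitContent_of_map_eq _ _ hιcg hcertϖ, hιcg⟩
  rw [hchar]
  exact (Ideal.span_singleton_mul_left_unit (hcu.map PowerSeries.C) g).symm

/-- **`MultiplicativeCharIdealMuZero W 3`** — EPW Cor. 5.1.4 at an odd prime (`hEPW`, good ⟶ mult) applied to §2's identity at the
partner; THREE partner facts + Mazur. [cite: EmertonPollackWeston2006, Cor. 5.1.4 and Thm. 5.1.3 (arXiv:math/0404484 p. 30)]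
[cite: YanZhu2024MainConjNonCM, Thm. 4.9 (§4.4; v4 Thm. 5.2)] [cite: Mazur1978, Cor. 4.1] -/
theorem multiplicativeCharIdealMuZero_three_of_partner_of_theoremB
    (hEPW : cor514_transfer_of_goodOrdinary_odd)
    (hYZ : YanZhu2026.thm49_charIdeal_eq_padicLFunction) (hTa : thm1_muAlg_transfer_goodOrdinary_of_mult_odd)
    (hMz : mazur_not_dvd_maninConstant_of_odd) (hpar : nonempty_modularParametrizationData)
    (hmult : W.HasMultiplicativeReductionAtPrime 3) (hirr : W.HasIrreducibleModPGaloisRep 3)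
    (hdiv : X11b.MultDivisibilityAt W 3) (hμ : X11a.MuAnZeroAt W 3)
    (hgoodA : A.HasGoodReductionAtPrime 3) (hordA : ¬ ((3 : ℕ) : ℤ) ∣ A.frobeniusTrace 3)
    (hiso : ∃ e : geomTorsion W ((3 : ℕ) : ℤ) ≃+ geomTorsion A ((3 : ℕ) : ℤ),
      ∀ (σ : Field.absoluteGaloisGroup ℚ) (P : geomTorsion W ((3 : ℕ) : ℤ)), e (σ • P) = σ • e P) :
    MultiplicativeCharIdealMuZero W 3 := by
  obtain ⟨e, he⟩ := hiso
  have hirrA : A.HasIrreducibleModPGaloisRep 3 := hasIrreducibleModPGaloisRep_of_torsionIso e he hirr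
  exact hEPW A W 3 (by decide) hgoodA hordA hmult ⟨e.symm, torsionIso_symm_smul e he⟩ hirrA
    (goodOrdinaryCharIdealMuZero_three_of_partner_of_theoremB W A hYZ hTa hMz hpar hmult hirr hdiv hμ hgoodA hordA
      ⟨e, he⟩)

end Partner

/-! ### §3 The lower half at an X11a pair with `p = 3` and a good-ordinary `3`-congruent partner, THREE partner facts -/

section Doors

variable {W : WeierstrassCurve ℚ} [W.IsElliptic] [W.IsGloballyMinimal] {p : ℕ} [Fact p.Prime]
  (A : WeierstrassCurve ℚ) [A.IsElliptic] [A.IsGloballyMinimal]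

/-- **The lower half at an X11a pair with `p = 3`, EITHER image, from a partner, the typed divisibility and named facts** — g4's
`missingLowerBoundAt_three_of_partner_of_multDivisibilityAt` with the partner bundle cut to THREE (EPW Cor. 5.1.4, Yan–Zhu 4.9, EPW
Thm. 1 alg) + Mazur 4.1 (already present: `μ^an(E,3) = 0`), Stein–Wuthrich 6.1 ×2, GZK, GS at the pair, modularity.  PER PAIR; CONDITIONAL.
[cite: EmertonPollackWeston2006, Thm. 1, Cor. 5.1.4] [cite: YanZhu2024MainConjNonCM, Thm. 4.9] [cite: Mazur1978, Cor. 4.1]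
[cite: SteinWuthrich2013, Thm. 6.1 (p. 20)] [cite: Miller2011LMS, Def. 1.1] -/
theorem _root_.Summit.BirchSwinnertonDyer.Rank1Residual.ClassX11a.missingLowerBoundAt_three_of_partner_of_multDivisibilityAt_of_theoremB
    (hNf : exists_isNewformOf) (hEPW : cor514_transfer_of_goodOrdinary_odd)
    (hYZ : YanZhu2026.thm49_charIdeal_eq_padicLFunction) (hTa : thm1_muAlg_transfer_goodOrdinary_of_mult_odd)
    (hMz : mazur_not_dvd_maninConstant_of_odd)
    (hJs : thm61_splitMultiplicative) (hJn : thm61_nonsplitMultiplicative)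
    (hGZK : rank_eq_analyticRank_of_analyticRank_le_one) (hGS : greenberg_stevens (W := W) (p := p))
    (hX : ClassX11a W p) (hp3 : p = 3) (hdiv : X11b.MultDivisibilityAt W p)
    (hgoodA : A.HasGoodReductionAtPrime p) (hordA : ¬ (p : ℤ) ∣ A.frobeniusTrace p)
    (hiso : ∃ e : geomTorsion W (p : ℤ) ≃+ geomTorsion A (p : ℤ),
      ∀ (σ : Field.absoluteGaloisGroup ℚ) (P : geomTorsion W (p : ℤ)), e (σ • P) = σ • e P) :
    MissingLowerBoundAt W p := by
  subst hp3
  have hmod : hasEntireLFunction_rat := hasEntireLFunction_rat_of_exists_isNewformOf hNf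
  have hpar : nonempty_modularParametrizationData :=
    nonempty_modularParametrizationData_of_exists_isNewformOf hNf
      IsNewformOf.exists_maninConstant_ne_zero_holds
  have hμ : X11a.MuAnZeroAt W 3 := MultThreeMuAn.muAnZeroAt_three_of_mult_of_irr hMz W hX.mult hX.irr
  have hMC : X2.MazurMainConjectureAt W 3 :=
    mazurMainConjectureAt_of_multiplicativeCharIdealMuZero W 3
      (multiplicativeCharIdealMuZero_three_of_partner_of_theoremB W A hEPW hYZ hTa hMz hpar hX.mult hX.irr hdiv hμ
        hgoodA hordA hiso)
  exact hX.missingLowerBoundAt_of_bsdp hGZK (bsdp_of_mazurMainConjectureAt_heightFree hJs hJn hGZK hmod hpar hGS hX hMC)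

/-- **The lower half at an X11a pair with `p = 3`, ANY image, from a good-ordinary `3`-congruent partner and PRINT-EXACT named facts,
THREE partner facts** — the contra door of p629328 (`missingLowerBoundAt_three_of_partner_of_contraFacts`) without `h3`, `hTn`:
surjective side through Kato–Wuthrich A32 + Lemma 20, non-surjective side through Kato 12.4 + §17.13 V′∕VI′∕XI′ `_contra`.  PER PAIR; CONDITIONAL.
[cite: EmertonPollackWeston2006, Thm. 1, Cor. 5.1.4] [cite: YanZhu2024MainConjNonCM, Thm. 4.9] [cite: Kato2004Asterisque, Thm. 12.4 (p. 221), §17.13 (pp. 279–280)]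
[cite: Wuthrich2014, Thm. 3, Lemma 20 (p. 399)] [cite: Miller2011LMS, Def. 1.1] -/
theorem _root_.Summit.BirchSwinnertonDyer.Rank1Residual.ClassX11a.missingLowerBoundAt_three_of_partner_of_contraFacts_of_theoremB
    (hNf : exists_isNewformOf) (hEPW : cor514_transfer_of_goodOrdinary_odd)
    (hYZ : YanZhu2026.thm49_charIdeal_eq_padicLFunction) (hTa : thm1_muAlg_transfer_goodOrdinary_of_mult_odd)
    (hMz : mazur_not_dvd_maninConstant_of_odd)
    (hKato : kato_charIdeal_dvd_multiplicative_of_surjective) (h20 : lemma20_surjective_threeAdic_of_semistable)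
    (h12 : Kato2004.thm12_4) (hns' : Kato2004.exists_multDivisibilityInputs_nonsplit_contra)
    (hsp' : Kato2004.exists_multDivisibilityInputs_split_contra)
    (hfine' : Kato2004.exists_multDivisibilityInputs_fine_contra)
    (hJs : thm61_splitMultiplicative) (hJn : thm61_nonsplitMultiplicative)
    (hGZK : rank_eq_analyticRank_of_analyticRank_le_one) (hGS : greenberg_stevens (W := W) (p := p))
    (hX : ClassX11a W p) (hp3 : p = 3)
    (hgoodA : A.HasGoodReductionAtPrime p) (hordA : ¬ (p : ℤ) ∣ A.frobeniusTrace p)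
    (hiso : ∃ e : geomTorsion W (p : ℤ) ≃+ geomTorsion A (p : ℤ),
      ∀ (σ : Field.absoluteGaloisGroup ℚ) (P : geomTorsion W (p : ℤ)), e (σ • P) = σ • e P) :
    MissingLowerBoundAt W p := by
  by_cases hsurj : Surj W p
  · have hsurj' : ∀ n : ℕ, W.HasSurjectiveModNGaloisRep (p ^ n : ℕ) := by
      subst hp3
      exact h20 W (Or.inr hX.mult) hsurj
    exact hX.missingLowerBoundAt_three_of_partner_of_multDivisibilityAt_of_theoremB A hNf hEPW hYZ hTa hMz hJs hJn hGZK hGS hp3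
      (OddChain.multDivisibilityAt_of_kato_of_surjective_pow hKato hX.ne_two hX.mult hsurj') hgoodA hordA hiso
  · have hμ : X11a.MuAnZeroAt W p := by
      subst hp3
      exact MultThreeMuAn.muAnZeroAt_three_of_mult_of_irr hMz W hX.mult hX.irr
    exact hX.missingLowerBoundAt_three_of_partner_of_multDivisibilityAt_of_theoremB A hNf hEPW hYZ hTa hMz hJs hJn hGZK hGS hp3
      (X11b.multDivisibilityAt_of_katoFacts_of_muAnZeroAt_contra_of_mazur Kato2004.nonempty_iwasawaH1Data_holds h12 hNf hns' hsp'
        hfine' hMz W p hX.ne_two hX.mult hX.irr hsurj hμ)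
      hgoodA hordA hiso

end Doors

/-! ### §4 The `p = 3` deep statement and the whole crux from 22 + THREE print facts and the residual statements (r12 composition) -/

section ClassLevel

/-- **r3's statement `stub_lowerThreeDeep` from the three-way cut, THREE partner facts** (= p629328's
`lowerThreeDeep_of_kodaira_of_partner_of_tresRamifie_of_contraFacts` without `h3`, `hTn`): Kodaira sub-locus through g3's member (Ribet's
additive drop `hRk`, Skinner–Urban 3.6.4-ram `hSU` [flag @3], Carayol–Livné `hCL`) and the surjective door; finite-flat off-Kodaira through
§3 and `hpartner`; très-ramifié off-Kodaira = `htres` (THE OPEN CORE).  CONDITIONAL; closes nothing by itself.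
[cite: SkinnerUrban2014, Thm. 1 (p. 2) = Thm. 3.6.4 (p. 43)] [cite: EmertonPollackWeston2006, Thm. 1, Cor. 5.1.4] [cite: YanZhu2024MainConjNonCM, Thm. 4.9]
[cite: Miller2011LMS, Def. 1.1] -/
theorem lowerThreeDeep_of_kodaira_of_partner_of_tresRamifie_of_contraFacts_of_theoremB
    (hNf : exists_isNewformOf)
    (h311 : thm311_cotorsion_weightK_member_ofLevel_odd) (hT1a : thm1_muAlg_of_weightK_member_ofLevel_odd)
    (hT1b : thm513_transfer_from_weightK_member_of_bdd_ofLevel_odd)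
    (h61 : DeligneSerre1974.thm61_exists_adicGaloisRep) (h326 : Hida2000_thm326_ordinary)
    (hKato : kato_charIdeal_dvd_multiplicative_of_surjective) (h20 : lemma20_surjective_threeAdic_of_semistable)
    (h12 : Kato2004.thm12_4) (hns' : Kato2004.exists_multDivisibilityInputs_nonsplit_contra)
    (hsp' : Kato2004.exists_multDivisibilityInputs_split_contra)
    (hfine' : Kato2004.exists_multDivisibilityInputs_fine_contra)
    (hMz : mazur_not_dvd_maninConstant_of_odd)
    (hJs : thm61_splitMultiplicative) (hJn : thm61_nonsplitMultiplicative)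
    (hGZK : rank_eq_analyticRank_of_analyticRank_le_one)
    (hGS : ∀ (W : WeierstrassCurve ℚ) [W.IsElliptic] [W.IsGloballyMinimal] (p : ℕ) [Fact p.Prime],
      p ≠ 2 → greenberg_stevens (W := W) (p := p))
    (hRk : ribet1990_levelLowering_gamma0_newform_at_three_additiveDrop)
    (hSU : thm364_rational_weightK_member_of_bdd_ofLevel_ram)
    (hCL : carayolLivne_additivePrime_dvd_level_of_congruent_newform)
    (hEPW : cor514_transfer_of_goodOrdinary_odd)
    (hYZ : YanZhu2026.thm49_charIdeal_eq_padicLFunction) (hTa : thm1_muAlg_transfer_goodOrdinary_of_mult_odd)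
    (hpartner : ∀ (W : WeierstrassCurve ℚ) [W.IsElliptic] [W.IsGloballyMinimal] (p : ℕ) [Fact p.Prime],
      ClassX11a W p → p = 3 → ¬ X11a.ShaAnUnit W p →
      ¬ (Surj W p ∧ ∃ v : HeightOneSpectrum ℤ, W.HasAdditiveReductionAt v ∧
          3 ∣ (W.kodairaSymbolAt v).componentGroupOrder ∧ ¬ natGenerator v ^ 3 ∣ W.conductorNorm ℤ) →
      p ∣ padicValInt p W.minimalDiscriminantInt →
      ∃ (A : WeierstrassCurve ℚ) (_ : A.IsElliptic) (_ : A.IsGloballyMinimal),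
        A.HasGoodReductionAtPrime p ∧ ¬ (p : ℤ) ∣ A.frobeniusTrace p ∧
        ∃ e : geomTorsion W (p : ℤ) ≃+ geomTorsion A (p : ℤ),
          ∀ (σ : Field.absoluteGaloisGroup ℚ) (P : geomTorsion W (p : ℤ)), e (σ • P) = σ • e P)
    (htres : ∀ (W : WeierstrassCurve ℚ) [W.IsElliptic] [W.IsGloballyMinimal] (p : ℕ) [Fact p.Prime],
      ClassX11a W p → p = 3 → ¬ X11a.ShaAnUnit W p →
      ¬ (Surj W p ∧ ∃ v : HeightOneSpectrum ℤ, W.HasAdditiveReductionAt v ∧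
          3 ∣ (W.kodairaSymbolAt v).componentGroupOrder ∧ ¬ natGenerator v ^ 3 ∣ W.conductorNorm ℤ) →
      ¬ p ∣ padicValInt p W.minimalDiscriminantInt → MissingLowerBoundAt W p) :
    ∀ (W : WeierstrassCurve ℚ) [W.IsElliptic] [W.IsGloballyMinimal] (p : ℕ) [Fact p.Prime],
      ClassX11a W p → p = 3 → ¬ X11a.ShaAnUnit W p → MissingLowerBoundAt W p := by
  intro W _ _ p _ hX hp3 hu
  by_cases hK : Surj W p ∧ ∃ v : HeightOneSpectrum ℤ, W.HasAdditiveReductionAt v ∧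
      3 ∣ (W.kodairaSymbolAt v).componentGroupOrder ∧ ¬ natGenerator v ^ 3 ∣ W.conductorNorm ℤ
  · -- the Kodaira sub-locus: g3's member, then the surjective door (`ρ̄` is onto there)
    obtain ⟨hsurj, v, hadd, h3Φ, hf2⟩ := hK
    obtain ⟨M, _, hpM, k, g, ι, hmem, hRat⟩ := memberRatEqAt_three_of_kodaira_of_facts hNf hRk hSU hCL hX hp3 hsurj v hadd h3Φ hf2
    have hμ : X11a.MuAnZeroAt W p := by
      subst hp3
      exact MultThreeMuAn.muAnZeroAt_three_of_mult_of_irr hMz W hX.mult hX.irr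
    have hsurj' : ∀ n : ℕ, W.HasSurjectiveModNGaloisRep (p ^ n : ℕ) := by
      subst hp3
      exact h20 W (Or.inr hX.mult) hsurj
    exact hX.missingLowerBoundAt_of_member_of_ratEq_of_surjective_pow hNf h311 hT1a hT1b h61 h326 hKato hJs hJn hGZK
      (hGS W p hX.ne_two) hsurj' hμ hpM g ι hmem hRat
  · by_cases hff : p ∣ padicValInt p W.minimalDiscriminantInt
    · -- finite flat at 3: the partner road, THREE partner facts
      obtain ⟨A, hAE, hAM, hgoodA, hordA, hiso⟩ := hpartner W p hX hp3 hu hK hff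
      exact hX.missingLowerBoundAt_three_of_partner_of_contraFacts_of_theoremB A hNf hEPW hYZ hTa hMz hKato h20 h12 hns' hsp' hfine' hJs hJn
        hGZK (hGS W p hX.ne_two) hp3 hgoodA hordA hiso
    · -- très ramifié at 3: the open core
      exact htres W p hX hp3 hu hK hff

/-- **Crux L BY NAME — the r12 skeleton-level composition** (CONDITIONAL; closes nothing): `hP` = r8's `stub_printFactsLower` (22 print-exact
facts; a THEOREM in the skeleton since r9), `hQ3` = the THREE partner facts (the proposed r12 stub `stub_threePartnerFactsLower`: EPW Cor.
5.1.4, Yan–Zhu 4.9, EPW Thm. 1 alg), `hcert5` (= `stub_muAnDeepFive_of_r5`), `hpartner` (= `stub_partnerThree`, a theorem), `htres`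
(= `stub_lowerTresRamifieThree`, THE OPEN CORE) ⊢ `Theses.ErratumRoadFive.X11aLowerHalf`.  At `p ≥ 5` exactly p629328's body (Wan's member,
surjective ∕ contra doors); at `p = 3` the previous theorem; unit pairs free.
[cite: Wan2015, Thm. 4 (pp. 4–5)] [cite: EmertonPollackWeston2006, Thm. 1, Thm. 5.1.3, Cor. 5.1.4] [cite: YanZhu2024MainConjNonCM, Thm. 4.9]
[cite: GreenbergLNM1716, §1 Conj. 1.11 (p. 61)] [cite: Miller2011LMS, Def. 1.1] -/
theorem x11aLowerHalf_of_printFactsLower_of_threePartnerFacts_of_muAnFive_of_partner_of_tresRamifie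
    (hP : exists_isNewformOf ∧
      thm311_cotorsion_weightK_member_ofLevel_odd ∧ thm1_muAlg_of_weightK_member_ofLevel_odd ∧
      Wan2015.thm4_rational_weightK_member_of_bdd_ofLevel_irred ∧
      thm513_transfer_from_weightK_member_of_bdd_ofLevel_odd ∧
      DeligneSerre1974.thm61_exists_adicGaloisRep ∧ Hida2000_thm326_ordinary ∧
      kato_charIdeal_dvd_multiplicative_of_surjective ∧ lemma20_surjective_threeAdic_of_semistable ∧
      Kato2004.thm12_4 ∧
      Kato2004.exists_multDivisibilityInputs_nonsplit_contra ∧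
      Kato2004.exists_multDivisibilityInputs_split_contra ∧
      Kato2004.exists_multDivisibilityInputs_fine_contra ∧
      mazur_not_dvd_maninConstant_of_odd ∧
      thm61_splitMultiplicative ∧ thm61_nonsplitMultiplicative ∧
      rank_eq_analyticRank_of_analyticRank_le_one ∧
      (∀ (W : WeierstrassCurve ℚ) [W.IsElliptic] [W.IsGloballyMinimal] (p : ℕ) [Fact p.Prime],
        p ≠ 2 → greenberg_stevens (W := W) (p := p)) ∧
      thm12_not_le_normalizer_splitCartan ∧
      ribet1990_levelLowering_gamma0_newform_at_three_additiveDrop ∧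
      thm364_rational_weightK_member_of_bdd_ofLevel_ram ∧
      carayolLivne_additivePrime_dvd_level_of_congruent_newform)
    (hQ3 : cor514_transfer_of_goodOrdinary_odd ∧ YanZhu2026.thm49_charIdeal_eq_padicLFunction ∧
      thm1_muAlg_transfer_goodOrdinary_of_mult_odd)
    (hcert5 : ∀ (W : WeierstrassCurve ℚ) [W.IsElliptic] [W.IsGloballyMinimal] (p : ℕ) [Fact p.Prime],
      ClassX11a W p → 5 ≤ p → ¬ X11a.ShaAnUnit W p → X11a.MuAnZeroAt W p)
    (hpartner : ∀ (W : WeierstrassCurve ℚ) [W.IsElliptic] [W.IsGloballyMinimal] (p : ℕ) [Fact p.Prime],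
      ClassX11a W p → p = 3 → ¬ X11a.ShaAnUnit W p →
      ¬ (Surj W p ∧ ∃ v : HeightOneSpectrum ℤ, W.HasAdditiveReductionAt v ∧
          3 ∣ (W.kodairaSymbolAt v).componentGroupOrder ∧ ¬ natGenerator v ^ 3 ∣ W.conductorNorm ℤ) →
      p ∣ padicValInt p W.minimalDiscriminantInt →
      ∃ (A : WeierstrassCurve ℚ) (_ : A.IsElliptic) (_ : A.IsGloballyMinimal),
        A.HasGoodReductionAtPrime p ∧ ¬ (p : ℤ) ∣ A.frobeniusTrace p ∧
        ∃ e : geomTorsion W (p : ℤ) ≃+ geomTorsion A (p : ℤ),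
          ∀ (σ : Field.absoluteGaloisGroup ℚ) (P : geomTorsion W (p : ℤ)), e (σ • P) = σ • e P)
    (htres : ∀ (W : WeierstrassCurve ℚ) [W.IsElliptic] [W.IsGloballyMinimal] (p : ℕ) [Fact p.Prime],
      ClassX11a W p → p = 3 → ¬ X11a.ShaAnUnit W p →
      ¬ (Surj W p ∧ ∃ v : HeightOneSpectrum ℤ, W.HasAdditiveReductionAt v ∧
          3 ∣ (W.kodairaSymbolAt v).componentGroupOrder ∧ ¬ natGenerator v ^ 3 ∣ W.conductorNorm ℤ) →
      ¬ p ∣ padicValInt p W.minimalDiscriminantInt → MissingLowerBoundAt W p) :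
    Theses.ErratumRoadFive.X11aLowerHalf := by
  obtain ⟨hNf, h311, hT1a, hT2, hT1b, h61, h326, hKato, h20, h12, hns', hsp', hfine', hMz, hJs, hJn, hGZK, hGS, -, hRk, hSU, hCL⟩ :=
    hP
  obtain ⟨hEPW, hYZ, hTa⟩ := hQ3
  intro W _ _ p hpF hX
  by_cases hu : X11a.ShaAnUnit W p
  · exact x11a_missingLowerBoundAt_of_shaAnUnit hu
  by_cases hp3 : p = 3
  · exact lowerThreeDeep_of_kodaira_of_partner_of_tresRamifie_of_contraFacts_of_theoremB hNf h311 hT1a hT1b h61 h326 hKato h20 h12 hns'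
      hsp' hfine' hMz hJs hJn hGZK hGS hRk hSU hCL hEPW hYZ hTa hpartner htres W p hX hp3 hu
  · -- `p ≥ 5`: the certificate + Wan's member + the surjective / contra doors (verbatim p629328)
    have hp5 : 5 ≤ p := (Fact.out : p.Prime).five_le_of_ne_two_of_ne_three hX.ne_two hp3
    have hμ : X11a.MuAnZeroAt W p := hcert5 W p hX hp5 hu
    obtain ⟨M, _, hpM, k, g, ι, hmem, hRat⟩ := memberRatEqAt_of_wan_of_five_le W p hNf hT2 hp5 hX.mult hX.irr
    by_cases hsurj : Surj W p
    · have hsurj' : ∀ n : ℕ, W.HasSurjectiveModNGaloisRep (p ^ n : ℕ) :=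
        kato_charIdeal_dvd_multiplicative_of_surjective.surjective_pow_of_five_le W p hp5 hsurj
      exact hX.missingLowerBoundAt_of_member_of_ratEq_of_surjective_pow hNf h311 hT1a hT1b h61 h326 hKato hJs hJn hGZK
        (hGS W p hX.ne_two) hsurj' hμ hpM g ι hmem hRat
    · exact hX.missingLowerBoundAt_of_member_of_ratEq_of_not_surj_contra hNf h311 hT1a hT1b h61 h326 h12 hns' hsp' hfine' hMz
        hJs hJn hGZK (hGS W p hX.ne_two) hsurj hμ hpM g ι hmem hRat

end ClassLevel

end Summit.BirchSwinnertonDyer.BirchSwinnertonDyer.Theorems.ThreePartner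

end
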